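import Summits.KontsevichZagierPeriods.KontsevichZagierPeriods.Theses.FermatIsogeny
import Summits.KontsevichZagierPeriods.KontsevichZagierPeriods.Theorems.TerasomaMultiplicationGammaHodgeSectorStubProducts

/-!
# `FermatSectorComplete` (stmt-KontsevichZagierPeriods-14252), line `birth` — stub
# `stub_shortPairsModBeta` (short Beta words collapse onto the β-sector)

The registered stub `stub_shortPairsModBeta` of the lead skeleton: for positive rational
exponents, a real algebraic `c`, the pinned cube representation
`ρ = [(0,1)^N, Π_j t_j^{x_j−1}(1−t_j)^{y_j−1}]` with `N ≤ 2` and the pinned representation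
`ρ' = [B_{2k} × (0,1)^{N'}, c·k!·Π_l (…)]` with `k + N' ≤ 2`, of equal value, the difference
`[ρ] − [ρ']` lies in `relations ⊔ closure (S_lin ∪ S_prod)` (β-linear / β-product pair
differences as extra axioms).

Proof, purely algebraic in the formal period ring `P = FormalRep ⧸ relations`:
`⟦ρ⟧ = Π β(x_j,y_j)` (`GammaHodgeSectorKO.cubeProduct_holds`),
`⟦ρ'⟧ = κ(c)·β(½,½)^k·Π β(x'_l,y'_l)` (`GammaHodgeSectorKO.stub_products`); both words are padded
to length two with `β(1,1) = 1` (`GammaHodgeSectorKO.stub_betaRelators`; `pad_cube`,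
`pad_ballCube`); the padded pair is realised as ONE
generator of `S_prod` (`KZ.exists_cubeBetaRep`, `KZ.toFormalPeriod_of_constMul`, value equality by
`evalP`), and the identity of classes is lifted back to `FormalRep` by `KZ.toFormalPeriod_eq_iff`
(`mem_relS_of_classes`). No transcendence input and no Hodge-type condition is used.

References: Kontsevich–Zagier 2001 §1.1–1.2, §4.1; Andrews–Askey–Roy 1999 §1.1.
-/

noncomputable section

open MeasureTheory Set
open scoped BigOperators

namespace Summit.KontsevichZagierPeriods.FermatIsogeny.FermatSectorCompleteShortPairs

open Literature.NumberTheory.Transcendental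
open Literature.NumberTheory.Transcendental.KZ
open Summit.KontsevichZagierPeriods.GammaHodgeSectorKO
open Summit.KontsevichZagierPeriods.GammaHodgeSectorNegative (IsCubeBetaRep IsBallCubeRep)

/-! ## Padding: words of length `≤ 2` as two-factor products (`β(1,1) = 1` is the third conjunct
of the landed `GammaHodgeSectorKO.stub_betaRelators`) -/

/-- PADDING ON THE CUBE SIDE: for `N ≤ 2`, `Π_j β(x_j,y_j) = β(a,b)·β(e,d)` for explicit positive
rationals (pad with `β(1,1) = 1`, `stub_betaRelators.2.2.1`). [folklore] -/
theorem pad_cube {N : ℕ} (hN : N ≤ 2) (x y : Fin N → ℚ) (hpos : ∀ j, 0 < x j ∧ 0 < y j) :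
    ∃ a b e d : ℚ, 0 < a ∧ 0 < b ∧ 0 < e ∧ 0 < d ∧
      ∏ j, betaClass (x j) (y j) = betaClass a b * betaClass e d := by
  obtain rfl | rfl | rfl : N = 0 ∨ N = 1 ∨ N = 2 := by omega
  · exact ⟨1, 1, 1, 1, one_pos, one_pos, one_pos, one_pos, by
      rw [Fin.prod_univ_zero, stub_betaRelators.2.2.1, mul_one]⟩
  · exact ⟨x 0, y 0, 1, 1, (hpos 0).1, (hpos 0).2, one_pos, one_pos, by
      rw [Fin.prod_univ_one, stub_betaRelators.2.2.1, mul_one]⟩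
  · exact ⟨x 0, y 0, x 1, y 1, (hpos 0).1, (hpos 0).2, (hpos 1).1, (hpos 1).2,
      Fin.prod_univ_two _⟩

/-- PADDING ON THE BALL × CUBE SIDE: for `k + N' ≤ 2`,
`β(½,½)^k · Π_l β(x'_l,y'_l) = β(a,b)·β(e,d)` for explicit positive rationals. [folklore] -/
theorem pad_ballCube {N' : ℕ} (k : ℕ) (hk : k + N' ≤ 2) (x' y' : Fin N' → ℚ)
    (hpos : ∀ l, 0 < x' l ∧ 0 < y' l) :
    ∃ a b e d : ℚ, 0 < a ∧ 0 < b ∧ 0 < e ∧ 0 < d ∧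
      betaClass (1 / 2) (1 / 2) ^ k * ∏ l, betaClass (x' l) (y' l) = betaClass a b * betaClass e d := by
  obtain rfl | rfl | rfl : k = 0 ∨ k = 1 ∨ k = 2 := by omega
  · obtain ⟨a, b, e, d, ha, hb, he, hd, h⟩ := pad_cube (by omega) x' y' hpos
    exact ⟨a, b, e, d, ha, hb, he, hd, by rw [pow_zero, one_mul, h]⟩
  · obtain rfl | rfl : N' = 0 ∨ N' = 1 := by omega
    · exact ⟨1 / 2, 1 / 2, 1, 1, by norm_num, by norm_num, one_pos, one_pos, by
        rw [pow_one, Fin.prod_univ_zero, stub_betaRelators.2.2.1]⟩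
    · exact ⟨1 / 2, 1 / 2, x' 0, y' 0, by norm_num, by norm_num, (hpos 0).1, (hpos 0).2, by
        rw [pow_one, Fin.prod_univ_one]⟩
  · obtain rfl : N' = 0 := by omega
    exact ⟨1 / 2, 1 / 2, 1 / 2, 1 / 2, by norm_num, by norm_num, by norm_num, by norm_num, by
      rw [Fin.prod_univ_zero, mul_one, pow_two]⟩

/-! ## The heart: one generator of `S_prod`, realised in `P` -/

/-- Positivity of two-entry exponent vectors. [folklore] -/
theorem forall_fin_two_pos {a b e d : ℚ} (ha : 0 < a) (hb : 0 < b) (he : 0 < e) (hd : 0 < d) :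
    ∀ j : Fin 2, 0 < ![a, e] j ∧ 0 < ![b, d] j :=
  Fin.forall_fin_two.2 ⟨⟨ha, hb⟩, ⟨he, hd⟩⟩

/-- **One `S_prod` generator modulo relations.** If a formal combination `c` has class
`β(a,b)·β(e,d) − κ(q)·(β(a',b')·β(e',d'))` in `P` (all exponents positive rationals, `q` real
algebraic) and evaluates to `0`, then `c ∈ relations ⊔ closure (S_lin ∪ S_prod)`: the two cube
representations `ρ₀ = [(0,1)², t₀^{a−1}(1−t₀)^{b−1}t₁^{e−1}(1−t₁)^{d−1}]` and
`ρ₀' = q · [(0,1)², (primed)]` exist (`KZ.exists_cubeBetaRep`), have these classes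
(`cubeProduct_holds`, `KZ.toFormalPeriod_of_constMul`), equal values (`evalP`), so
`[ρ₀] − [ρ₀'] ∈ S_prod` and `c − ([ρ₀] − [ρ₀']) ∈ relations` (`KZ.toFormalPeriod_eq_iff`).
[cite: KontsevichZagier2001, §1.2] -/
theorem mem_relS_of_classes {a b e d a' b' e' d' : ℚ} (ha : 0 < a) (hb : 0 < b) (he : 0 < e)
    (hd : 0 < d) (ha' : 0 < a') (hb' : 0 < b') (he' : 0 < e') (hd' : 0 < d') (q : ℝ)
    (hq : IsAlgebraic ℚ q) (c : FormalRep)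
    (hc : toFormalPeriod c =
      betaClass a b * betaClass e d - kap q hq * (betaClass a' b' * betaClass e' d'))
    (hv : eval c = 0) :
    c ∈ Literature.NumberTheory.Transcendental.KZ.relations ⊔ AddSubgroup.closure ({z : Literature.NumberTheory.Transcendental.KZ.FormalRep | ∃ (a b a' b' : ℚ) (c : ℝ) (ρ ρ' : Literature.NumberTheory.Transcendental.KZ.IntegralRep 1), 0 < a ∧ 0 < b ∧ 0 < a' ∧ 0 < b' ∧ IsAlgebraic ℚ c ∧ ρ.domain = {x | x 0 ∈ Set.Ioo (0:ℝ) 1} ∧ Set.EqOn ρ.integrand (fun x => (x 0) ^ ((a:ℝ) - 1) * (1 - x 0) ^ ((b:ℝ) - 1)) ρ.domain ∧ ρ'.domain = {x | x 0 ∈ Set.Ioo (0:ℝ) 1} ∧ Set.EqOn ρ'.integrand (fun x => c * (x 0) ^ ((a':ℝ) - 1) * (1 - x 0) ^ ((b':ℝ) - 1)) ρ'.domain ∧ ρ.value = ρ'.value ∧ z = Literature.NumberTheory.Transcendental.KZ.of ρ - Literature.NumberTheory.Transcendental.KZ.of ρ'} ∪ {z : Literature.NumberTheory.Transcendental.KZ.FormalRep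 | ∃ (a b e d a' b' e' d' : ℚ) (q : ℝ) (ρ ρ' : Literature.NumberTheory.Transcendental.KZ.IntegralRep 2), 0 < a ∧ 0 < b ∧ 0 < e ∧ 0 < d ∧ 0 < a' ∧ 0 < b' ∧ 0 < e' ∧ 0 < d' ∧ IsAlgebraic ℚ q ∧ ρ.domain = {x | ∀ i, x i ∈ Set.Ioo (0:ℝ) 1} ∧ Set.EqOn ρ.integrand (fun x => (x 0) ^ ((a:ℝ) - 1) * (1 - x 0) ^ ((b:ℝ) - 1) * (x 1) ^ ((e:ℝ) - 1) * (1 - x 1) ^ ((d:ℝ) - 1)) ρ.domain ∧ ρ'.domain = {x | ∀ i, x i ∈ Set.Ioo (0:ℝ) 1} ∧ Set.EqOn ρ'.integrand (fun x => q * (x 0) ^ ((a':ℝ) - 1) * (1 - x 0) ^ ((b':ℝ) - 1) * (x 1) ^ ((e':ℝ) - 1) * (1 - x 1) ^ ((d':ℝ) - 1)) ρ'.domain ∧ ρ.value = ρ'.value ∧ z = Literature.NumberTheory.Transcendental.KZ.of ρ - Literature.NumberTheory.Transcendental.KZ.of ρ'}) := by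
  -- the two cube representations on `(0,1)²`
  have hpos₀ : ∀ j : Fin 2, 0 < ![a, e] j ∧ 0 < ![b, d] j := forall_fin_two_pos ha hb he hd
  have hpos₁ : ∀ j : Fin 2, 0 < ![a', e'] j ∧ 0 < ![b', d'] j := forall_fin_two_pos ha' hb' he' hd'
  obtain ⟨ρ₀, h₀d, h₀i⟩ := exists_cubeBetaRep ![a, e] ![b, d] hpos₀
  obtain ⟨ρ₁, h₁d, h₁i⟩ := exists_cubeBetaRep ![a', e'] ![b', d'] hpos₁
  -- their classes in `P`
  have hc₀ : toFormalPeriod (of ρ₀) = betaClass a b * betaClass e d := by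
    have h := cubeProduct_holds _ _ ρ₀ hpos₀ ⟨h₀d, h₀i⟩
    rw [Fin.prod_univ_two] at h
    exact h
  have hc₁ : toFormalPeriod (of (ρ₁.constMul q hq)) =
      kap q hq * (betaClass a' b' * betaClass e' d') := by
    have h := cubeProduct_holds _ _ ρ₁ hpos₁ ⟨h₁d, h₁i⟩
    rw [Fin.prod_univ_two] at h
    rw [toFormalPeriod_of_constMul q hq ρ₁, h]
    rfl
  -- the difference has the class of `c`, hence equal values
  have hcs : toFormalPeriod (of ρ₀ - of (ρ₁.constMul q hq)) = toFormalPeriod c := by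
    rw [map_sub, hc₀, hc₁, hc]
  have hval : ρ₀.value = (ρ₁.constMul q hq).value := by
    have h : evalP (toFormalPeriod (of ρ₀ - of (ρ₁.constMul q hq))) = evalP (toFormalPeriod c) := by
      rw [hcs]
    rwa [evalP_toFormalPeriod c, hv, map_sub, map_sub, evalP_toFormalPeriod_of,
      evalP_toFormalPeriod_of, sub_eq_zero] at h
  -- `[ρ₀] − [ρ₀']` is a generator of `S_prod`
  have hs : of ρ₀ - of (ρ₁.constMul q hq) ∈ {z : Literature.NumberTheory.Transcendental.KZ.FormalRep | ∃ (a b a' b' : ℚ) (c : ℝ) (ρ ρ' : Literature.NumberTheory.Transcendental.KZ.IntegralRep 1), 0 < a ∧ 0 < b ∧ 0 < a' ∧ 0 < b' ∧ IsAlgebraic ℚ c ∧ ρ.domain = {x | x 0 ∈ Set.Ioo (0:ℝ) 1} ∧ Set.EqOn ρ.integrand (fun x => (x 0) ^ ((a:ℝ) - 1) * (1 - x 0) ^ ((b:ℝ) - 1)) ρ.domain ∧ ρ'.domain = {x | x 0 ∈ Set.Ioo (0:ℝ) 1} ∧ Set.EqOn ρ'.integrand (fun x => c * (x 0) ^ ((a':ℝ)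 - 1) * (1 - x 0) ^ ((b':ℝ) - 1)) ρ'.domain ∧ ρ.value = ρ'.value ∧ z = Literature.NumberTheory.Transcendental.KZ.of ρ - Literature.NumberTheory.Transcendental.KZ.of ρ'} ∪ {z : Literature.NumberTheory.Transcendental.KZ.FormalRep | ∃ (a b e d a' b' e' d' : ℚ) (q : ℝ) (ρ ρ' : Literature.NumberTheory.Transcendental.KZ.IntegralRep 2), 0 < a ∧ 0 < b ∧ 0 < e ∧ 0 < d ∧ 0 < a' ∧ 0 < b' ∧ 0 < e' ∧ 0 < d' ∧ IsAlgebraic ℚ q ∧ ρ.domain = {x | ∀ i, x i ∈ Set.Ioo (0:ℝ) 1} ∧ Set.EqOn ρ.integrand (fun x => (x 0) ^ ((a:ℝ) - 1) * (1 - x 0) ^ ((b:ℝ) - 1) * (x 1) ^ ((e:ℝ) - 1) * (1 - x 1) ^ ((d:ℝ) - 1)) ρ.domain ∧ ρ'.domain = {x | ∀ i, x i ∈ Set.Ioo (0:ℝ) 1} ∧ Set.EqOn ρ'.integrand (fun x => q * (x 0) ^ ((a':ℝ) - 1) * (1 - x 0) ^ ((b':ℝ) - 1) * (x 1) ^ ((e':ℝ)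 - 1) * (1 - x 1) ^ ((d':ℝ) - 1)) ρ'.domain ∧ ρ.value = ρ'.value ∧ z = Literature.NumberTheory.Transcendental.KZ.of ρ - Literature.NumberTheory.Transcendental.KZ.of ρ'} := by
    refine Set.mem_union_right _ ⟨a, b, e, d, a', b', e', d', q, ρ₀, ρ₁.constMul q hq, ha, hb, he,
      hd, ha', hb', he', hd', hq, h₀d, ?_, h₁d, ?_, hval, rfl⟩
    · intro t ht
      rw [h₀i ht]
      simp only [Fin.prod_univ_two, Matrix.cons_val_zero, Matrix.cons_val_one]
      ring
    · intro t ht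
      rw [IntegralRep.integrand_constMul]
      have ht' : t ∈ ρ₁.domain := ht
      simp only [h₁i ht', Fin.prod_univ_two, Matrix.cons_val_zero, Matrix.cons_val_one]
      ring
  -- lift back to `FormalRep`
  have hrel : c - (of ρ₀ - of (ρ₁.constMul q hq)) ∈ relations := toFormalPeriod_eq_iff.mp hcs.symm
  rw [← sub_add_cancel c (of ρ₀ - of (ρ₁.constMul q hq))]
  exact AddSubgroup.add_mem _ (AddSubgroup.mem_sup_left hrel)
    (AddSubgroup.mem_sup_right (AddSubgroup.subset_closure hs))

/-! ## The registered stub -/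

/-- **STUB `stub_shortPairsModBeta` of the `FermatSectorComplete` skeleton (line birth)** — short
Beta words collapse onto the β-sector: for positive rational exponents, a real algebraic `c`, the
pinned cube representation with `N ≤ 2` factors and the pinned `2k`-ball × cube representation
with `k + N' ≤ 2`, of equal value, `[ρ] − [ρ'] ∈ relations ⊔ closure (S_lin ∪ S_prod)`.
Classes in `P` by `cubeProduct_holds` / `stub_products`, padding to two factors by
`β(1,1) = 1`, and `mem_relS_of_classes`. [cite: KontsevichZagier2001, §1.2] -/
theorem stub_shortPairsModBeta :
    ∀ (N N' k : ℕ) (x y : Fin N → ℚ) (x' y' : Fin N' → ℚ) (c : ℝ), N ≤ 2 → k + N' ≤ 2 → (∀ j, 0 < x j ∧ 0 < y j) → (∀ l, 0 < x' l ∧ 0 < y' l) → IsAlgebraic ℚ c → ∀ (ρ : Literature.NumberTheory.Transcendental.KZ.IntegralRep N) (ρ' : Literature.NumberTheory.Transcendental.KZ.IntegralRep (2 * k + N')), ρ.domain = {t | ∀ j, t j ∈ Set.Ioo (0:ℝ) 1} → Set.EqOn ρ.integrand (fun t => ∏ j, (t j) ^ ((x j : ℝ) - 1) * (1 - t j) ^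 ((y j : ℝ) - 1)) ρ.domain → ρ'.domain = {z | (∑ i : Fin (2 * k), (z (Fin.castAdd N' i)) ^ 2) < 1 ∧ ∀ l : Fin N', z (Fin.natAdd (2 * k) l) ∈ Set.Ioo (0:ℝ) 1} → Set.EqOn ρ'.integrand (fun z => c * (k.factorial : ℝ) * ∏ l, (z (Fin.natAdd (2 * k) l)) ^ ((x' l : ℝ) - 1) * (1 - z (Fin.natAdd (2 * k) l)) ^ ((y' l : ℝ) - 1)) ρ'.domain → ρ.value = ρ'.value → Literature.NumberTheory.Transcendental.KZ.of ρ - Literature.NumberTheory.Transcendental.KZ.of ρ' ∈ Literature.NumberTheory.Transcendental.KZ.relations ⊔ AddSubgroup.closure ({z : Literature.NumberTheory.Transcendental.KZ.FormalRep | ∃ (a b a' b' : ℚ) (c : ℝ) (ρ ρ' : Literature.NumberTheory.Transcendental.KZ.IntegralRep 1), 0 < a ∧ 0 < b ∧ 0 < a' ∧ 0 < b' ∧ IsAlgebraic ℚ c ∧ ρ.domain = {x | x 0 ∈ Set.Ioo (0:ℝ) 1} ∧ Set.EqOn ρ.integrand (fun x => (x 0) ^ ((a:ℝ) - 1) * (1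 - x 0) ^ ((b:ℝ) - 1)) ρ.domain ∧ ρ'.domain = {x | x 0 ∈ Set.Ioo (0:ℝ) 1} ∧ Set.EqOn ρ'.integrand (fun x => c * (x 0) ^ ((a':ℝ) - 1) * (1 - x 0) ^ ((b':ℝ) - 1)) ρ'.domain ∧ ρ.value = ρ'.value ∧ z = Literature.NumberTheory.Transcendental.KZ.of ρ - Literature.NumberTheory.Transcendental.KZ.of ρ'} ∪ {z : Literature.NumberTheory.Transcendental.KZ.FormalRep | ∃ (a b e d a' b' e' d' : ℚ) (q : ℝ) (ρ ρ' : Literature.NumberTheory.Transcendental.KZ.IntegralRep 2), 0 < a ∧ 0 < b ∧ 0 < e ∧ 0 < d ∧ 0 < a' ∧ 0 < b' ∧ 0 < e' ∧ 0 < d' ∧ IsAlgebraic ℚ q ∧ ρ.domain = {x | ∀ i, x i ∈ Set.Ioo (0:ℝ) 1} ∧ Set.EqOn ρ.integrand (fun x => (x 0) ^ ((a:ℝ) - 1) * (1 - x 0) ^ ((b:ℝ) - 1) * (x 1) ^ ((e:ℝ) - 1) * (1 - x 1) ^ ((d:ℝ) - 1)) ρ.domain ∧ ρ'.domain = {x |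 ∀ i, x i ∈ Set.Ioo (0:ℝ) 1} ∧ Set.EqOn ρ'.integrand (fun x => q * (x 0) ^ ((a':ℝ) - 1) * (1 - x 0) ^ ((b':ℝ) - 1) * (x 1) ^ ((e':ℝ) - 1) * (1 - x 1) ^ ((d':ℝ) - 1)) ρ'.domain ∧ ρ.value = ρ'.value ∧ z = Literature.NumberTheory.Transcendental.KZ.of ρ - Literature.NumberTheory.Transcendental.KZ.of ρ'}) := by
  intro N N' k x y x' y' c hN hk hpos hpos' hc ρ ρ' hd hi hd' hi' hval
  obtain ⟨a, b, e, d, ha, hb, he, hd0, hL⟩ := pad_cube hN x y hpos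
  obtain ⟨a', b', e', d', ha', hb', he', hd0', hR⟩ := pad_ballCube k hk x' y' hpos'
  have h1 : toFormalPeriod (of ρ) = betaClass a b * betaClass e d :=
    (cubeProduct_holds x y ρ hpos ⟨hd, hi⟩).trans hL
  have h2 : toFormalPeriod (of ρ') = kap c hc * (betaClass a' b' * betaClass e' d') := by
    rw [stub_products.2.1 k x' y' c hc ρ' hpos' ⟨hd', hi'⟩, mul_assoc, hR]
  refine mem_relS_of_classes ha hb he hd0 ha' hb' he' hd0' c hc (of ρ - of ρ') ?_ ?_
  · rw [map_sub, h1, h2]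
  · rw [map_sub, eval_of, eval_of, hval, sub_self]

end Summit.KontsevichZagierPeriods.FermatIsogeny.FermatSectorCompleteShortPairs

end
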